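import Literature.Analysis.FluidPDE.DivFormPotential
import Literature.Analysis.FluidPDE.WeylLemmaBall
import Literature.Analysis.FluidPDE.NewtonPotential
import Literature.Analysis.PDE.CoordWordDeriv
import HarnessLib

/-!
# Word derivatives of smooth solutions of `Δu = div A` on a ball: the potential-theoretic
# representation with interior estimates

Analysis/FluidPDE proofs file (theorems only; no definitions, no named facts). The elliptic half
of one step of the quantitative higher-regularity bootstrap for essentially bounded Navier–Stokes
solutions (Serrin 1962; Robinson–Rodrigo–Sadowski 2016, Thm. 13.7, §13.3.2 Steps 3–4: at each
time the velocity is recovered from the vorticity through `Δu = -curl ω`, here in the form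
`Δu_b = Σ_c ∂_c A_{bc}` for the spin `A = ∇u - ∇uᵀ` of a divergence-free field; Seregin–Šverák
2009, §2 p. 8, the named fact `NSBoundedHigherRegularityBounds`). At a fixed time and for
**smooth** data (in the bootstrap: mollified slices) it proves, for a word derivative
`w = ∂_v u` of a smooth scalar `u` with `Δu = Σ_c ∂_c A_c` on a ball `B(0, ρ₀)` and a cut-off
`χ ∈ C_c^∞(B(0, ρ₁))`, `χ = 1` on `B(0, ρ₂)`, `ρ₂ < ρ₁ < ρ₀`:

* `SerrinBootstrap.laplacian_cwd`, `integral_cwd_mul_eq`: word derivatives commute with `Δ`,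
  and move across the `L²` pairing with the sign `(-1)^{|v|}`;
* `SerrinBootstrap.potential_eq_convolution`, `hasFDerivAt_sum_potential`,
  `fderiv_sum_potential_apply`: the divergence-form Newtonian potential
  `N[g](x) = Σ_c ∫ g_c(y) ∂_cΓ(x - y) dy` of smooth compactly supported densities is `C¹` with
  `∂ᵢ N[g] = N[∂ᵢ g]` (Mathlib's `HasCompactSupport.hasFDerivAt_convolution_right`);
* `SerrinBootstrap.integral_sub_potential_mul_laplacian_eq_zero` — **the harmonic remainder**:
  `H = ∂_v u - N[∂_v(χ A)]` is weakly (indeed classically) harmonic on `B(0, ρ₂)`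
  (Gilbarg–Trudinger, Lemma 4.2: `ΔN[g] = div g`);
* `SerrinBootstrap.abs_cwd_sub_potential_le` — **the interior estimate**: for every Weyl margin
  `r₁ > 0` there is `K` (depending on `r₁` only) with
  `|∂ᵢ∂_v u(x) - N[∂ᵢ∂_v(χ A)](x)| ≤ K ∫_{B(0,ρ₂)} |∂_v u - N[∂_v(χ A)]|` for `|x| < ρ₂ - r₁`
  (Weyl's lemma with the interior Lipschitz estimate, the accepted
  `WeylLemmaBall.exists_lipschitz_rep_of_weaklyHarmonic`).

The three uses in the bootstrap (sup bounds, `L^m` bounds, `L²` bounds of the next derivative of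
the velocity in terms of the corresponding norms of the derivatives of the spin) are then pure
potential estimates for `N[·]`.

## References

* D. Gilbarg, N. S. Trudinger, *Elliptic Partial Differential Equations of Second Order* (2001),
  Lemma 4.1–4.2, (2.17); H. Weyl, Duke Math. J. 7 (1940), Lemma 2. [`GilbargTrudinger2001`]
* J. C. Robinson, J. L. Rodrigo, W. Sadowski, *The Three-Dimensional Navier–Stokes Equations*
  (CUP 2016), Thm. 13.7, §13.3.2 Steps 3–4. [`RobinsonRodrigoSadowskiCUP2016`]
* J. Serrin, Arch. Rational Mech. Anal. 9 (1962) 187–195. [`Serrin1962`]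
-/

noncomputable section

open MeasureTheory Set Function Filter Topology TopologicalSpace Metric ContinuousLinearMap
open scoped NNReal ENNReal RealInnerProductSpace Convolution ContDiff Laplacian

namespace Literature.Analysis.FluidPDE

namespace SerrinBootstrap

open Literature.Analysis.FunctionSpaces Literature.Analysis.PDE NewtonPotentialHolder

/-! ### Word derivatives, the Laplacian and integration by parts -/

/-- **Word derivatives commute with the Laplacian** on smooth functions:
`∂_v (Δφ) = Δ (∂_v φ)` (Schwarz; the tree's `fderiv_laplacian_apply`, iterated). [folklore] -/
theorem laplacian_cwd {φ : EuclideanSpace ℝ (Fin 3) → ℝ} (hφ : ContDiff ℝ ∞ φ) :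
    ∀ v : List (Fin 3), cwd v (Δ φ) = Δ (cwd v φ) := by
  intro v
  induction v with
  | nil => rfl
  | cons i v ih =>
    funext x
    rw [cwd_cons]
    show fderiv ℝ (cwd v (Δ φ)) x (bv i) = Δ (cwd (i :: v) φ) x
    rw [ih]
    have h3 : ContDiff ℝ 3 (cwd v φ) := (contDiff_cwd hφ v).of_le (by norm_cast)
    rw [fderiv_laplacian_apply h3]
    rfl

/-- **Moving a word derivative across the real pairing**: `∫ (∂_v f) g = (-1)^{|v|} ∫ f (∂_v g)`
for smooth `f, g` one of which has compact support (the tree's `integral_inner_cwd_eq` for real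
values). [cite: Evans2010, App. C.2, Thm. 2] -/
theorem integral_cwd_mul_eq {f g : EuclideanSpace ℝ (Fin 3) → ℝ} (hf : ContDiff ℝ ∞ f)
    (hg : ContDiff ℝ ∞ g) (h : HasCompactSupport f ∨ HasCompactSupport g) (v : List (Fin 3)) :
    ∫ x, cwd v f x * g x = (-1) ^ v.length * ∫ x, f x * cwd v g x := by
  have key := integral_inner_cwd_eq (W := ℝ) hf hg h v
  simpa only [RCLike.inner_apply, conj_trivial, mul_comm] using key

/-- **Green's second identity**, real smooth functions, the second compactly supported:
`∫ u Δψ = ∫ (Δu) ψ`. [folklore] -/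
theorem integral_mul_laplacian_eq_integral_laplacian_mul {u ψ : EuclideanSpace ℝ (Fin 3) → ℝ}
    (hu : ContDiff ℝ 2 u) (hψ : ContDiff ℝ 2 ψ) (hψc : HasCompactSupport ψ) :
    ∫ x, u x * Δ ψ x = ∫ x, Δ u x * ψ x := by
  have h := integral_mul_laplacian_comm hu hψ hψc
  -- `h : ∫ ψ Δu = ∫ (Δψ) u`
  calc ∫ x, u x * Δ ψ x = ∫ x, Δ ψ x * u x := by congr 1 with x; ring
    _ = ∫ x, ψ x * Δ u x := h.symm
    _ = ∫ x, Δ u x * ψ x := by congr 1 with x; ring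

/-- **Integration by parts, one derivative**, real smooth functions, the second compactly
supported: `∫ (∂_c F) ψ = -∫ F ∂_c ψ`. [cite: Evans2010, App. C.2, Thm. 2] -/
theorem integral_fderiv_mul_eq_neg {F ψ : EuclideanSpace ℝ (Fin 3) → ℝ} (hF : ContDiff ℝ 1 F)
    (hψ : ContDiff ℝ 1 ψ) (hψc : HasCompactSupport ψ) (c : Fin 3) :
    ∫ x, fderiv ℝ F x (bv c) * ψ x = -∫ x, F x * fderiv ℝ ψ x (bv c) := by
  have key := integral_inner_fderiv_eq_neg (W := ℝ) hF hψ (Or.inr hψc) c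
  simpa only [RCLike.inner_apply, conj_trivial, mul_comm] using key

/-! ### The divergence-form Newtonian potential of smooth compactly supported densities -/

/-- `∂ⱼΓ` is locally integrable on `ℝ³` (`|∂ⱼΓ(z)| ≤ (4π|z|²)⁻¹`). [folklore] -/
theorem locallyIntegrable_newtonKernelGrad (j : Fin 3) :
    LocallyIntegrable (newtonKernelGrad j) (volume : Measure (EuclideanSpace ℝ (Fin 3))) := by
  have hk := isSingularKernel_newtonKernelGrad j
  rw [locallyIntegrable_iff]
  intro K hK
  obtain ⟨R, hR⟩ := hK.isBounded.subset_ball 0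
  refine IntegrableOn.mono_set ?_ hR
  refine Integrable.mono' (((integrableOn_ball_norm_rpow_neg (by norm_num : (2 : ℝ) < 3) R)).const_mul
    ((4 * Real.pi)⁻¹)) (hk.measurable.aestronglyMeasurable) (Eventually.of_forall fun z => ?_)
  rw [Real.norm_eq_abs]
  exact hk.abs_le z

/-- The one-component potential as a convolution:
`∫ g(y) ∂ⱼΓ(x - y) dy = (∂ⱼΓ ⋆ g)(x)`. [folklore] -/
theorem potential_eq_convolution (j : Fin 3) (g : EuclideanSpace ℝ (Fin 3) → ℝ)
    (x : EuclideanSpace ℝ (Fin 3)) :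
    ∫ y, g y * newtonKernelGrad j (x - y) = (newtonKernelGrad j ⋆[lsmul ℝ ℝ, volume] g) x := by
  rw [convolution_def]
  simp only [lsmul_apply, smul_eq_mul]
  rw [← integral_sub_left_eq_self (fun t => newtonKernelGrad j t * g (x - t)) volume x]
  congr 1 with y
  simp only [sub_sub_cancel]
  ring

/-- **The potential of a smooth compactly supported density is differentiable with
`∂ N[g] = N[∂ g]`** (differentiation under the convolution with the locally integrable kernel
`∂ⱼΓ`; Mathlib's `HasCompactSupport.hasFDerivAt_convolution_right`; Gilbarg–Trudinger,
Lemma 4.1). [cite: GilbargTrudinger2001, Lemma 4.1] -/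
theorem hasFDerivAt_potential {j : Fin 3} {g : EuclideanSpace ℝ (Fin 3) → ℝ} (hg : ContDiff ℝ 1 g)
    (hgc : HasCompactSupport g) (x : EuclideanSpace ℝ (Fin 3)) :
    HasFDerivAt (fun x => ∫ y, g y * newtonKernelGrad j (x - y))
      ((newtonKernelGrad j ⋆[(lsmul ℝ ℝ).precompR (EuclideanSpace ℝ (Fin 3)), volume] fderiv ℝ g) x) x := by
  have h := hgc.hasFDerivAt_convolution_right (L := lsmul ℝ ℝ) (μ := volume)
    (locallyIntegrable_newtonKernelGrad j) hg x
  have e : (fun x => ∫ y, g y * newtonKernelGrad j (x - y)) =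
      (newtonKernelGrad j ⋆[lsmul ℝ ℝ, volume] g) := funext fun x => potential_eq_convolution j g x
  rw [e]
  exact h

/-- The derivative of the one-component potential in direction `w`:
`∂_w (∫ g(y) ∂ⱼΓ(· - y) dy)(x) = ∫ (∂_w g)(y) ∂ⱼΓ(x - y) dy`. [cite: GilbargTrudinger2001, Lemma 4.1] -/
theorem fderiv_potential_apply {j : Fin 3} {g : EuclideanSpace ℝ (Fin 3) → ℝ} (hg : ContDiff ℝ 1 g)
    (hgc : HasCompactSupport g) (x w : EuclideanSpace ℝ (Fin 3)) :
    fderiv ℝ (fun x => ∫ y, g y * newtonKernelGrad j (x - y)) x w =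
      ∫ y, fderiv ℝ g y w * newtonKernelGrad j (x - y) := by
  rw [(hasFDerivAt_potential hg hgc x).fderiv,
    convolution_precompR_apply (L := lsmul ℝ ℝ) (locallyIntegrable_newtonKernelGrad j)
      (hgc.fderiv ℝ) (hg.continuous_fderiv one_ne_zero) x w,
    ← potential_eq_convolution]

/-- The sum potential `N[g] = Σ_c ∫ g_c(y) ∂_cΓ(· - y) dy` of smooth compactly supported
densities is differentiable, with `∂_w N[g] = N[∂_w g]`. [cite: GilbargTrudinger2001, Lemma 4.1] -/
theorem fderiv_sum_potential_apply {g : Fin 3 → EuclideanSpace ℝ (Fin 3) → ℝ}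
    (hg : ∀ c, ContDiff ℝ 1 (g c)) (hgc : ∀ c, HasCompactSupport (g c)) (x w : EuclideanSpace ℝ (Fin 3)) :
    DifferentiableAt ℝ (fun x => ∑ c, ∫ y, g c y * newtonKernelGrad c (x - y)) x ∧
    fderiv ℝ (fun x => ∑ c, ∫ y, g c y * newtonKernelGrad c (x - y)) x w =
      ∑ c, ∫ y, fderiv ℝ (g c) y w * newtonKernelGrad c (x - y) := by
  have hd : ∀ c, DifferentiableAt ℝ (fun x => ∫ y, g c y * newtonKernelGrad c (x - y)) x := fun c =>
    (hasFDerivAt_potential (hg c) (hgc c) x).differentiableAt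
  refine ⟨?_, ?_⟩
  · exact DifferentiableAt.fun_sum fun c _ => hd c
  · rw [fderiv_fun_sum fun c _ => hd c, _root_.sum_apply]
    exact Finset.sum_congr rfl fun c _ => fderiv_potential_apply (hg c) (hgc c) x w

/-- The vector field of components `g_c` is in every `L^p` when the components are continuous
with compact support, and is supported where they are. [folklore] -/
theorem memLp_toLp_of_continuous {g : Fin 3 → EuclideanSpace ℝ (Fin 3) → ℝ}
    (hg : ∀ c, Continuous (g c)) (hgc : ∀ c, HasCompactSupport (g c)) (p : ℝ≥0∞) :
    MemLp (fun y => (WithLp.toLp 2 fun c => g c y : EuclideanSpace ℝ (Fin 3))) p volume := by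
  have hcont : Continuous fun y => (WithLp.toLp 2 fun c => g c y : EuclideanSpace ℝ (Fin 3)) :=
    (PiLp.continuous_toLp 2 _).comp (continuous_pi fun c => hg c)
  have hsupp : HasCompactSupport fun y => (WithLp.toLp 2 fun c => g c y : EuclideanSpace ℝ (Fin 3)) := by
    refine HasCompactSupport.of_support_subset_isCompact
      (isCompact_iUnion fun c => (hgc c).isCompact) ?_
    intro y hy
    rw [mem_support] at hy
    by_contra hne
    apply hy
    ext c
    simp only [PiLp.zero_apply]
    by_contra h'
    exact hne (mem_iUnion.2 ⟨c, subset_tsupport _ h'⟩)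
  exact hcont.memLp_of_hasCompactSupport hsupp

/-- The support of the vector field of components is contained in any set containing all the
component supports. [folklore] -/
theorem support_toLp_subset {g : Fin 3 → EuclideanSpace ℝ (Fin 3) → ℝ} {S : Set (EuclideanSpace ℝ (Fin 3))}
    (h : ∀ c, support (g c) ⊆ S) :
    support (fun y => (WithLp.toLp 2 fun c => g c y : EuclideanSpace ℝ (Fin 3))) ⊆ S := by
  intro y hy
  rw [mem_support] at hy
  by_contra hyS
  apply hy
  ext c
  simp only [PiLp.zero_apply]
  by_contra h'
  exact hyS (h c h')

/-! ### The harmonic remainder -/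

set_option maxHeartbeats 1600000 in
/-- **The harmonic remainder of a word derivative** (Gilbarg–Trudinger, Lemma 4.2: `ΔN[g] = div g`
weakly; Robinson–Rodrigo–Sadowski 2016, §13.3.2 Step 3). Let `u`, `A_c` (`c = 1, 2, 3`) be smooth
with `Δu = Σ_c ∂_c A_c` on `B(0, ρ₀)`, let `χ ∈ C_c^∞` be supported in `B(0, ρ₁)`, `ρ₁ ≤ ρ₀`, with
`χ = 1` on `B(0, ρ₂)`, and let `v` be a word. With `g_c = ∂_v(χ A_c)` and
`N(x) = Σ_c ∫ g_c(y) ∂_cΓ(x - y) dy`, the function `H = ∂_v u - N` is weakly harmonic on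
`B(0, ρ₂)`: `∫ H Δφ = 0` for every `φ ∈ C_c^∞` supported in `B(0, ρ₂)`.
[cite: GilbargTrudinger2001, Lemma 4.2] -/
theorem integral_sub_potential_mul_laplacian_eq_zero {ρ₀ ρ₁ ρ₂ : ℝ} (h₁₀ : ρ₁ ≤ ρ₀) (h₂₁ : ρ₂ ≤ ρ₁)
    {u : EuclideanSpace ℝ (Fin 3) → ℝ} (hu : ContDiff ℝ ∞ u)
    {A : Fin 3 → EuclideanSpace ℝ (Fin 3) → ℝ} (hA : ∀ c, ContDiff ℝ ∞ (A c))
    (hPDE : ∀ x ∈ ball (0 : EuclideanSpace ℝ (Fin 3)) ρ₀, Δ u x = ∑ c, fderiv ℝ (A c) x (bv c))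
    {χ : EuclideanSpace ℝ (Fin 3) → ℝ} (hχ : ContDiff ℝ ∞ χ)
    (hχsupp : tsupport χ ⊆ ball (0 : EuclideanSpace ℝ (Fin 3)) ρ₁)
    (hχ1 : ∀ x ∈ ball (0 : EuclideanSpace ℝ (Fin 3)) ρ₂, χ x = 1) (v : List (Fin 3))
    {φ : EuclideanSpace ℝ (Fin 3) → ℝ} (hφ : ContDiff ℝ ∞ φ) (hφc : HasCompactSupport φ)
    (hφsupp : tsupport φ ⊆ ball (0 : EuclideanSpace ℝ (Fin 3)) ρ₂) :
    ∫ x, (cwd v u x - ∑ c, ∫ y, cwd v (fun y => χ y * A c y) y * newtonKernelGrad c (x - y)) * Δ φ x = 0 := by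
  -- the densities
  have hχc : HasCompactSupport χ :=
    HasCompactSupport.of_support_subset_isCompact (isCompact_closedBall 0 ρ₁)
      ((subset_tsupport χ).trans (hχsupp.trans ball_subset_closedBall))
  have hχA : ∀ c, ContDiff ℝ ∞ (fun y => χ y * A c y) := fun c => hχ.mul (hA c)
  have hχAc : ∀ c, HasCompactSupport (fun y => χ y * A c y) := fun c => hχc.mul_right
  set g : Fin 3 → EuclideanSpace ℝ (Fin 3) → ℝ := fun c => cwd v (fun y => χ y * A c y) with hg
  have hg_smooth : ∀ c, ContDiff ℝ ∞ (g c) := fun c => contDiff_cwd (hχA c) v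
  have hg_supp : ∀ c, HasCompactSupport (g c) := fun c => hasCompactSupport_cwd (hχAc c) v
  have hg_tsupp : ∀ c, tsupport (g c) ⊆ ball (0 : EuclideanSpace ℝ (Fin 3)) ρ₁ := fun c =>
    (tsupport_cwd_subset v _).trans ((tsupport_mul_subset_left (f := χ) (g := A c)).trans hχsupp)
  set fvec : EuclideanSpace ℝ (Fin 3) → EuclideanSpace ℝ (Fin 3) := fun y => WithLp.toLp 2 fun c => g c y
    with hfvec
  have hfvec4 : MemLp fvec (ENNReal.ofReal 4) volume :=
    memLp_toLp_of_continuous (fun c => (hg_smooth c).continuous) hg_supp _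
  have hfsupp : support fvec ⊆ ball (0 : EuclideanSpace ℝ (Fin 3)) ρ₁ :=
    support_toLp_subset fun c => (subset_tsupport _).trans (hg_tsupp c)
  -- integrability of the two pieces against `Δφ`
  have hΔφ : ContDiff ℝ ∞ (Δ φ) := by
    have : Δ φ = cwd ([] : List (Fin 3)) (Δ φ) := rfl
    rw [show Δ φ = Δ (cwd ([] : List (Fin 3)) φ) from rfl]
    exact contDiff_laplacian hφ
  have hΔφc : HasCompactSupport (Δ φ) := DivFormPotential.hasCompactSupport_laplacian hφc
  have hw : ContDiff ℝ ∞ (cwd v u) := contDiff_cwd hu v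
  have hNc : Continuous fun x => ∑ c, ∫ y, g c y * newtonKernelGrad c (x - y) := by
    have h := DivFormPotential.continuous_sum_potential (p := 4) (by norm_num) hfvec4 hfsupp
    refine h.congr fun x => Finset.sum_congr rfl fun c _ => ?_
    simp [hfvec]
  have I1 : Integrable fun x => cwd v u x * Δ φ x :=
    (hw.continuous.mul hΔφ.continuous).integrable_of_hasCompactSupport hΔφc.mul_left
  have I2 : Integrable fun x => (∑ c, ∫ y, g c y * newtonKernelGrad c (x - y)) * Δ φ x :=
    (hNc.mul hΔφ.continuous).integrable_of_hasCompactSupport hΔφc.mul_left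
  -- split
  have esplit : ∫ x, (cwd v u x - ∑ c, ∫ y, g c y * newtonKernelGrad c (x - y)) * Δ φ x =
      (∫ x, cwd v u x * Δ φ x) - ∫ x, (∑ c, ∫ y, g c y * newtonKernelGrad c (x - y)) * Δ φ x := by
    rw [← integral_sub I1 I2]
    congr 1 with x; ring
  rw [esplit]
  -- the potential piece: `∫ N Δφ = -∫ Σ_c g_c ∂_cφ`
  have hpot : ∫ x, (∑ c, ∫ y, g c y * newtonKernelGrad c (x - y)) * Δ φ x =
      -∫ y, ∑ c, g c y * fderiv ℝ φ y (bv c) := by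
    have h := DivFormPotential.integral_sum_potential_mul_laplacian (p := 4) (by norm_num) hfvec4 hfsupp hφ hφc
    simp only [hfvec, PiLp.toLp_apply, bv_eq_single] at h ⊢
    exact h
  -- the word-derivative piece: `∫ (∂_v u) Δφ = (-1)^{|v|} ∫ (Δu) ∂_vφ = (-1)^{|v|+1} Σ_c ∫ χ A_c ∂_c ∂_v φ`
  have hcwdφ : ContDiff ℝ ∞ (cwd v φ) := contDiff_cwd hφ v
  have hcwdφc : HasCompactSupport (cwd v φ) := hasCompactSupport_cwd hφc v
  have hcwdφ_supp : tsupport (cwd v φ) ⊆ ball (0 : EuclideanSpace ℝ (Fin 3)) ρ₂ :=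
    (tsupport_cwd_subset v φ).trans hφsupp
  have hword : ∫ x, cwd v u x * Δ φ x =
      (-1) ^ v.length * -∑ c, ∫ x, χ x * A c x * fderiv ℝ (cwd v φ) x (bv c) := by
    rw [integral_cwd_mul_eq hu hΔφ (Or.inr hΔφc) v, laplacian_cwd hφ v,
      integral_mul_laplacian_eq_integral_laplacian_mul (hu.of_le (by norm_cast))
        (hcwdφ.of_le (by norm_cast)) hcwdφc]
    congr 1
    -- use the equation on the support of `∂_v φ`
    have e1 : (fun x => Δ u x * cwd v φ x) = fun x => (∑ c, fderiv ℝ (A c) x (bv c)) * cwd v φ x := by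
      funext x
      by_cases hx : x ∈ tsupport (cwd v φ)
      · rw [hPDE x ((hcwdφ_supp.trans (ball_subset_ball (h₂₁.trans h₁₀))) hx)]
      · rw [image_eq_zero_of_notMem_tsupport hx, mul_zero, mul_zero]
    rw [e1]
    have hIc : ∀ c, Integrable fun x => fderiv ℝ (A c) x (bv c) * cwd v φ x := fun c =>
      ((((hA c).continuous_fderiv (by simp)).clm_apply continuous_const).mul hcwdφ.continuous)
        |>.integrable_of_hasCompactSupport hcwdφc.mul_left
    simp_rw [Finset.sum_mul]
    rw [integral_finsetSum _ fun c _ => hIc c, ← Finset.sum_neg_distrib]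
    refine Finset.sum_congr rfl fun c _ => ?_
    rw [integral_fderiv_mul_eq_neg ((hA c).of_le (by norm_cast)) (hcwdφ.of_le (by norm_cast)) hcwdφc c]
    congr 1
    refine integral_congr_ae (Eventually.of_forall fun x => ?_)
    -- `χ = 1` on the support of `∂_v φ`
    by_cases hx : x ∈ tsupport (fun x => fderiv ℝ (cwd v φ) x (bv c))
    · have hx' : x ∈ ball (0 : EuclideanSpace ℝ (Fin 3)) ρ₂ :=
        hcwdφ_supp ((tsupport_fderiv_apply_subset ℝ (bv c)) hx)
      simp only [hχ1 x hx', one_mul]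
    · simp only [image_eq_zero_of_notMem_tsupport hx, mul_zero]
  -- the density piece: `∫ Σ_c g_c ∂_cφ = (-1)^{|v|} Σ_c ∫ χ A_c ∂_v ∂_c φ`, and `∂_v∂_c = ∂_c∂_v`
  have hdens : ∫ y, ∑ c, g c y * fderiv ℝ φ y (bv c) =
      (-1) ^ v.length * ∑ c, ∫ x, χ x * A c x * fderiv ℝ (cwd v φ) x (bv c) := by
    have hIc : ∀ c, Integrable fun y => g c y * fderiv ℝ φ y (bv c) := fun c =>
      ((hg_smooth c).continuous.mul ((hφ.continuous_fderiv (by simp)).clm_apply continuous_const))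
        |>.integrable_of_hasCompactSupport (hg_supp c).mul_right
    rw [integral_finsetSum _ fun c _ => hIc c, Finset.mul_sum]
    refine Finset.sum_congr rfl fun c _ => ?_
    have hφc' : ContDiff ℝ ∞ (fun y => fderiv ℝ φ y (bv c)) :=
      (hφ.fderiv_right (m := ∞) (by norm_cast)).clm_apply contDiff_const
    rw [show g c = cwd v (fun y => χ y * A c y) from rfl,
      integral_cwd_mul_eq (hχA c) hφc' (Or.inl (hχAc c)) v]
    congr 1
    refine integral_congr_ae (Eventually.of_forall fun x => ?_)
    -- `∂_v ∂_c φ = ∂_c ∂_v φ`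
    have e : cwd v (fun y => fderiv ℝ φ y (bv c)) x = fderiv ℝ (cwd v φ) x (bv c) := by
      have h1 : cwd v (fun y => fderiv ℝ φ y (bv c)) = cwd (v ++ [c]) φ := by
        rw [cwd_append_singleton]
      rw [h1, show fderiv ℝ (cwd v φ) x (bv c) = cwd (c :: v) φ x from by rw [cwd_cons]]
      rw [cwd_perm hφ (List.perm_append_singleton c v).symm]
    change χ x * A c x * cwd v (fun y => fderiv ℝ φ y (bv c)) x = χ x * A c x * fderiv ℝ (cwd v φ) x (bv c)
    rw [e]
  rw [hword, hpot, hdens]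
  ring

/-! ### The interior estimate for the harmonic remainder -/

set_option maxHeartbeats 1600000 in
/-- **Interior estimate for word derivatives of solutions of `Δu = div A`** (Robinson–Rodrigo–
Sadowski 2016, §13.3.2 Steps 3–4; Gilbarg–Trudinger Lemma 4.2 with Weyl's lemma and the interior
Lipschitz estimate for harmonic functions). For every Weyl margin `r₁ > 0` there is `K ≥ 0`
(depending on `r₁` only) such that: for smooth `u`, `A_c` with `Δu = Σ_c ∂_c A_c` on `B(0, ρ₀)`, a
cut-off `χ ∈ C_c^∞` supported in `B(0, ρ₁)`, `ρ₁ ≤ ρ₀`, with `χ = 1` on `B(0, ρ₂)`, `ρ₂ ≤ ρ₁`,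
every word `v`, direction `i` and point `|x| < ρ₂ - r₁`,
`|∂ᵢ∂_v u(x) - N[∂ᵢ∂_v(χA)](x)| ≤ K ∫_{B(0,ρ₂)} |∂_v u - N[∂_v(χA)]|`,
`N[g](x) = Σ_c ∫ g_c(y) ∂_cΓ(x - y) dy`: the next derivative of `u` is the potential of the next
derivative of the (cut-off) density up to the derivative of a harmonic function controlled in
`L¹`. [cite: RobinsonRodrigoSadowskiCUP2016, §13.3.2 Steps 3–4 (proof of Thm. 13.7); GilbargTrudinger2001 Lemma 4.2] -/
theorem abs_cwd_sub_potential_le {r₁ : ℝ} (hr₁ : 0 < r₁) :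
    ∃ K : ℝ, 0 ≤ K ∧ ∀ (ρ₀ ρ₁ ρ₂ : ℝ), ρ₁ ≤ ρ₀ → ρ₂ ≤ ρ₁ →
      ∀ (u : EuclideanSpace ℝ (Fin 3) → ℝ), ContDiff ℝ ∞ u →
      ∀ (A : Fin 3 → EuclideanSpace ℝ (Fin 3) → ℝ), (∀ c, ContDiff ℝ ∞ (A c)) →
      (∀ x ∈ ball (0 : EuclideanSpace ℝ (Fin 3)) ρ₀, Δ u x = ∑ c, fderiv ℝ (A c) x (bv c)) →
      ∀ (χ : EuclideanSpace ℝ (Fin 3) → ℝ), ContDiff ℝ ∞ χ →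
      tsupport χ ⊆ ball (0 : EuclideanSpace ℝ (Fin 3)) ρ₁ →
      (∀ x ∈ ball (0 : EuclideanSpace ℝ (Fin 3)) ρ₂, χ x = 1) →
      ∀ (v : List (Fin 3)) (i : Fin 3), ∀ x ∈ ball (0 : EuclideanSpace ℝ (Fin 3)) (ρ₂ - r₁),
        |cwd (i :: v) u x -
            ∑ c, ∫ y, cwd (i :: v) (fun y => χ y * A c y) y * newtonKernelGrad c (x - y)| ≤
          K * ∫ y in ball (0 : EuclideanSpace ℝ (Fin 3)) ρ₂,
            |cwd v u y - ∑ c, ∫ z, cwd v (fun y => χ y * A c y) z * newtonKernelGrad c (y - z)| := by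
  obtain ⟨K, hK0, hW⟩ := WeylLemmaBall.exists_lipschitz_rep_of_weaklyHarmonic hr₁
  refine ⟨K, hK0, ?_⟩
  intro ρ₀ ρ₁ ρ₂ h₁₀ h₂₁ u hu A hA hPDE χ hχ hχsupp hχ1 v i x hx
  -- the densities and the potential
  have hχc : HasCompactSupport χ :=
    HasCompactSupport.of_support_subset_isCompact (isCompact_closedBall 0 ρ₁)
      ((subset_tsupport χ).trans (hχsupp.trans ball_subset_closedBall))
  have hχA : ∀ c, ContDiff ℝ ∞ (fun y => χ y * A c y) := fun c => hχ.mul (hA c)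
  have hχAc : ∀ c, HasCompactSupport (fun y => χ y * A c y) := fun c => hχc.mul_right
  set g : Fin 3 → EuclideanSpace ℝ (Fin 3) → ℝ := fun c => cwd v (fun y => χ y * A c y) with hg
  have hg_smooth : ∀ c, ContDiff ℝ ∞ (g c) := fun c => contDiff_cwd (hχA c) v
  have hg_supp : ∀ c, HasCompactSupport (g c) := fun c => hasCompactSupport_cwd (hχAc c) v
  have hg_tsupp : ∀ c, tsupport (g c) ⊆ ball (0 : EuclideanSpace ℝ (Fin 3)) ρ₁ := fun c =>
    (tsupport_cwd_subset v _).trans ((tsupport_mul_subset_left (f := χ) (g := A c)).trans hχsupp)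
  set fvec : EuclideanSpace ℝ (Fin 3) → EuclideanSpace ℝ (Fin 3) := fun y => WithLp.toLp 2 fun c => g c y
    with hfvec
  have hfvec4 : MemLp fvec (ENNReal.ofReal 4) volume :=
    memLp_toLp_of_continuous (fun c => (hg_smooth c).continuous) hg_supp _
  have hfsupp : support fvec ⊆ ball (0 : EuclideanSpace ℝ (Fin 3)) ρ₁ :=
    support_toLp_subset fun c => (subset_tsupport _).trans (hg_tsupp c)
  set N : EuclideanSpace ℝ (Fin 3) → ℝ := fun x => ∑ c, ∫ y, g c y * newtonKernelGrad c (x - y) with hN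
  have hNc : Continuous N := by
    have h := DivFormPotential.continuous_sum_potential (p := 4) (by norm_num) hfvec4 hfsupp
    refine h.congr fun x => Finset.sum_congr rfl fun c _ => ?_
    simp [hfvec]
  have hNd : ∀ x w, DifferentiableAt ℝ N x ∧ fderiv ℝ N x w =
      ∑ c, ∫ y, fderiv ℝ (g c) y w * newtonKernelGrad c (x - y) := fun x w =>
    fderiv_sum_potential_apply (fun c => (hg_smooth c).of_le (by norm_cast)) hg_supp x w
  -- the remainder
  set w : EuclideanSpace ℝ (Fin 3) → ℝ := cwd v u with hwdef
  have hw : ContDiff ℝ ∞ w := contDiff_cwd hu v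
  set H : EuclideanSpace ℝ (Fin 3) → ℝ := fun x => w x - N x with hH
  have hHc : Continuous H := hw.continuous.sub hNc
  have hHd : ∀ x, DifferentiableAt ℝ H x := fun x =>
    ((hw.differentiable (by simp)) x).sub (hNd x 0).1
  -- weakly harmonic on `B(0, ρ₂)`
  have hHi : IntegrableOn H (ball (0 : EuclideanSpace ℝ (Fin 3)) ρ₂) volume :=
    (hHc.continuousOn.integrableOn_compact (isCompact_closedBall 0 ρ₂)).mono_set ball_subset_closedBall
  have hHharm : ∀ φ : EuclideanSpace ℝ (Fin 3) → ℝ,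
      IsTestFunctionOn (⟨ball (0 : EuclideanSpace ℝ (Fin 3)) ρ₂, isOpen_ball⟩ :
        Opens (EuclideanSpace ℝ (Fin 3))) φ →
      ∫ x in ball (0 : EuclideanSpace ℝ (Fin 3)) ρ₂, H x * Δ φ x = 0 := by
    intro φ hφ
    have h := integral_sub_potential_mul_laplacian_eq_zero h₁₀ h₂₁ hu hA hPDE hχ hχsupp hχ1 v
      hφ.contDiff hφ.hasCompactSupport hφ.tsupport_subset
    rw [setIntegral_eq_integral_of_forall_compl_eq_zero]
    · exact h
    · intro x hx
      have hx' : x ∉ tsupport φ := fun h' => hx (hφ.tsupport_subset h')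
      rw [laplacian_eq_zero_of_notMem_tsupport hx', mul_zero]
  obtain ⟨H', hHH', -, hLip⟩ := hW 0 ρ₂ H hHi hHharm
  set L : ℝ := K * ∫ y in ball (0 : EuclideanSpace ℝ (Fin 3)) ρ₂, |H y| with hL
  have hL0 : 0 ≤ L := mul_nonneg hK0 (integral_nonneg fun y => abs_nonneg _)
  have hLip' : LipschitzWith L.toNNReal H' := by
    refine LipschitzWith.of_dist_le_mul fun a b => ?_
    rw [Real.dist_eq, dist_eq_norm, Real.coe_toNNReal _ hL0]
    exact hLip a b
  -- `H = H'` on the inner ball (both continuous), hence `‖DH(x)‖ ≤ L`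
  have hEq : EqOn H H' (ball (0 : EuclideanSpace ℝ (Fin 3)) (ρ₂ - r₁)) :=
    Measure.eqOn_open_of_ae_eq hHH' isOpen_ball hHc.continuousOn hLip'.continuous.continuousOn
  have hfd : fderiv ℝ H x = fderiv ℝ H' x :=
    Filter.EventuallyEq.fderiv_eq (Filter.eventuallyEq_of_mem (isOpen_ball.mem_nhds hx) hEq)
  have hbound : ‖fderiv ℝ H x‖ ≤ L := by
    rw [hfd]
    have := norm_fderiv_le_of_lipschitz ℝ (x₀ := x) hLip'
    rwa [Real.coe_toNNReal _ hL0] at this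
  -- identify `DH(x) eᵢ`
  have hDw : fderiv ℝ w x (bv i) = cwd (i :: v) u x := by rw [hwdef, cwd_cons]
  have hDN : fderiv ℝ N x (bv i) = ∑ c, ∫ y, cwd (i :: v) (fun y => χ y * A c y) y * newtonKernelGrad c (x - y) := by
    rw [(hNd x (bv i)).2]
    rfl
  have hDH : fderiv ℝ H x (bv i) = cwd (i :: v) u x -
      ∑ c, ∫ y, cwd (i :: v) (fun y => χ y * A c y) y * newtonKernelGrad c (x - y) := by
    rw [hH, fderiv_fun_sub ((hw.differentiable (by simp)) x) (hNd x 0).1]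
    rw [_root_.sub_apply, hDw, hDN]
  rw [← hDH]
  calc |fderiv ℝ H x (bv i)| = ‖fderiv ℝ H x (bv i)‖ := (Real.norm_eq_abs _).symm
    _ ≤ ‖fderiv ℝ H x‖ * ‖(bv i : EuclideanSpace ℝ (Fin 3))‖ := le_opNorm _ _
    _ = ‖fderiv ℝ H x‖ := by rw [norm_bv, mul_one]
    _ ≤ L := hbound
    _ = K * ∫ y in ball (0 : EuclideanSpace ℝ (Fin 3)) ρ₂, |H y| := rfl

end SerrinBootstrap

end Literature.Analysis.FluidPDE

end
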